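import Mathlib
import HarnessLib
import Summits.AtomisticToContinuum.Crystallization.Theorems.PricedLinkCensusSoftFourRingsFacetKinds

/-!
# Soft four-rings, endgame: preparations for the type-A cell lemma

Support file for `SoftFourRings` (route `PricedLinkCensus`, sub-problem `Crystallization`),
endgame step (E1) of the evidence file (§12.8): small set-theoretic helpers
(`eq_four_of_three_mem`, `eq_three_of_two_mem`, `tri_swap23`, `tri_rotl`, `side_eq_pair`,
`mem_bonds_of_nb_zero`) and, for a **type-A vertex** `v` (bonds `w 0, …, w 3`, bonded link pairs
exactly `{w i, w j}` and `{w j, w k}`):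

* `not_mem_bonds_gamma` — no bonded link pair contains the `γ`-index `l`;
* `ne_link_of_bond_gamma` — a point bonded to `w l` is not a bond of `v`;
* `facet_through_alpha` — a facet through the `α`-bond `{v, w j}` is one of the two bond
  triangles (no third facet through a hull edge).
-/

namespace Summit.AtomisticToContinuum.Crystallization.Theorems

open Real RealInnerProductSpace Literature.Geometry.DiscreteGeometry

/-- A four-element `Finset` with three known distinct members. -/
theorem eq_four_of_three_mem {α : Type*} [DecidableEq α] {T : Finset α} (h4 : T.card = 4)
    {a b d : α} (ha : a ∈ T) (hb : b ∈ T) (hd : d ∈ T) (hab : a ≠ b) (had : a ≠ d)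
    (hbd : b ≠ d) : ∃ x, x ≠ a ∧ x ≠ b ∧ x ≠ d ∧ T = {a, b, d, x} := by
  have hsub : ({a, b, d} : Finset α) ⊆ T := by
    intro y hy
    simp only [Finset.mem_insert, Finset.mem_singleton] at hy
    rcases hy with rfl | rfl | rfl <;> assumption
  have h3 : ({a, b, d} : Finset α).card = 3 := by
    rw [Finset.card_insert_of_notMem (by simp [hab, had]), Finset.card_pair hbd]
  have hdiff : (T \ {a, b, d}).card = 1 := by
    rw [Finset.card_sdiff_of_subset hsub, h4, h3]
  obtain ⟨x, hx⟩ := Finset.card_eq_one.1 hdiff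
  have hxmem : x ∈ T \ {a, b, d} := by rw [hx]; exact Finset.mem_singleton_self _
  rw [Finset.mem_sdiff] at hxmem
  simp only [Finset.mem_insert, Finset.mem_singleton, not_or] at hxmem
  refine ⟨x, hxmem.2.1, hxmem.2.2.1, hxmem.2.2.2, ?_⟩
  have : T = {a, b, d} ∪ (T \ {a, b, d}) := (Finset.union_sdiff_of_subset hsub).symm
  rw [this, hx]
  ext y
  simp only [Finset.mem_union, Finset.mem_insert, Finset.mem_singleton]
  tauto


/-- A three-element `Finset` with two known distinct members. -/
theorem eq_three_of_two_mem {α : Type*} [DecidableEq α] {T : Finset α} (h3 : T.card = 3)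
    {a b : α} (ha : a ∈ T) (hb : b ∈ T) (hab : a ≠ b) : ∃ x, x ≠ a ∧ x ≠ b ∧ T = {a, b, x} := by
  obtain ⟨y, z, hya, hza, hyz, hT⟩ := eq_three_of_mem ha h3
  have hb' : b ∈ ({a, y, z} : Finset α) := hT ▸ hb
  simp only [Finset.mem_insert, Finset.mem_singleton] at hb'
  rcases hb' with rfl | rfl | rfl
  · exact absurd rfl hab
  · exact ⟨z, hza, hyz.symm, hT⟩
  · refine ⟨y, hya, hyz, ?_⟩
    rw [hT]
    ext u
    simp only [Finset.mem_insert, Finset.mem_singleton]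
    tauto

/-- `{a, b, d} = {a, d, b}`. -/
theorem tri_swap23 {α : Type*} [DecidableEq α] (a b d : α) :
    ({a, b, d} : Finset α) = {a, d, b} := by
  rw [Finset.pair_comm]

/-- `{a, b, d} = {b, d, a}`. -/
theorem tri_rotl {α : Type*} [DecidableEq α] (a b d : α) :
    ({a, b, d} : Finset α) = {b, d, a} := by
  ext x
  simp only [Finset.mem_insert, Finset.mem_singleton]
  tauto

section Generic

variable {X : Finset (EuclideanSpace ℝ (Fin 3))} {B : Finset (Finset (EuclideanSpace ℝ (Fin 3)))}

/-- A side of a facet through `x` is `{x, y}` for a tight point `y ≠ x`. -/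
theorem side_eq_pair {c : EuclideanSpace ℝ (Fin 3)} {S : Finset (EuclideanSpace ℝ (Fin 3))} (hS : S ∈ edgesOfFacet X c) {x : EuclideanSpace ℝ (Fin 3)}
    (hx : x ∈ S) : ∃ y ∈ tightSet X c, y ≠ x ∧ S = {x, y} := by
  classical
  unfold edgesOfFacet at hS
  obtain ⟨hSH, hSsub⟩ := Finset.mem_filter.1 hS
  obtain ⟨p, q, hpq, rfl⟩ := Finset.card_eq_two.1 (card_eq_two_of_mem_hullEdges hSH)
  rw [Finset.mem_insert, Finset.mem_singleton] at hx
  rcases hx with rfl | rfl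
  · exact ⟨q, hSsub (by simp), hpq.symm, rfl⟩
  · exact ⟨p, hSsub (by simp), hpq, Finset.pair_comm _ _⟩

/-- In a facet with no side outside `B`, every side lies in `B`. -/
theorem mem_bonds_of_nb_zero {c : EuclideanSpace ℝ (Fin 3)}
    (hnb : ((edgesOfFacet X c).filter (fun T => T ∉ B)).card = 0) {S : Finset (EuclideanSpace ℝ (Fin 3))}
    (hS : S ∈ edgesOfFacet X c) : S ∈ B := by
  by_contra h
  have := one_le_nb_of_side hS h
  omega

end Generic

section Setting

variable {X : Finset (EuclideanSpace ℝ (Fin 3))} {B : Finset (Finset (EuclideanSpace ℝ (Fin 3)))}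
  (hT : musinTarasov2012_tammes_thirteen) (hX1 : ∀ y ∈ X, ‖y‖ = 1) (hcard : X.card = 12)
  (hsepX : ∀ u ∈ X, ∀ u' ∈ X, u ≠ u' → ⟪u, u'⟫ ≤ 1 - 1 / (2 * (101 / 100 : ℝ) ^ 2))
  (hB : ∀ T ∈ B, ∃ u ∈ X, ∃ u' ∈ X, u ≠ u' ∧ 1 - (101 / 100 : ℝ) ^ 2 / 2 ≤ ⟪u, u'⟫ ∧ T = {u, u'})
  (hBcard : B.card = 24)
  (hdeg : ∀ v ∈ X, ∃ w : Fin 4 → EuclideanSpace ℝ (Fin 3), (∀ k, w k ∈ X) ∧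
    Function.Injective w ∧ (∀ k, w k ≠ v) ∧
    (∀ k, ({v, w k} : Finset (EuclideanSpace ℝ (Fin 3))) ∈ B) ∧
    ∀ y, ({v, y} : Finset (EuclideanSpace ℝ (Fin 3))) ∈ B → ∃ k, y = w k)
  {v : EuclideanSpace ℝ (Fin 3)} (hv : v ∈ X) (w : Fin 4 → EuclideanSpace ℝ (Fin 3))
  (hwX : ∀ k, w k ∈ X) (hwinj : Function.Injective w) (hwv : ∀ k, w k ≠ v)
  (hvw : ∀ k, ({v, w k} : Finset (EuclideanSpace ℝ (Fin 3))) ∈ B)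
  (hvonly : ∀ y, ({v, y} : Finset (EuclideanSpace ℝ (Fin 3))) ∈ B → ∃ k, y = w k)
  {i j k l : Fin 4} (hnd : [i, j, k, l].Nodup)
  (hBij : ({w i, w j} : Finset (EuclideanSpace ℝ (Fin 3))) ∈ B)
  (hBjk : ({w j, w k} : Finset (EuclideanSpace ℝ (Fin 3))) ∈ B)
  (hNB : ∀ a b : Fin 4, a ≠ b → ({w a, w b} : Finset (EuclideanSpace ℝ (Fin 3))) ∈ B →
    ({a, b} : Finset (Fin 4)) = {i, j} ∨ ({a, b} : Finset (Fin 4)) = {j, k})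

include hnd hNB in
/-- No bonded pair of the link contains the `γ`-index `l`. -/
theorem not_mem_bonds_gamma (s : Fin 4) (hs : s ≠ l) :
    ({w s, w l} : Finset (EuclideanSpace ℝ (Fin 3))) ∉ B := by
  intro h
  have hl : l ∈ ({s, l} : Finset (Fin 4)) := by simp
  have hnd' : i ≠ l ∧ j ≠ l ∧ k ≠ l := by
    simp only [List.nodup_cons, List.mem_cons, not_or, List.not_mem_nil,
      not_false_eq_true, and_true, List.nodup_nil] at hnd
    exact ⟨hnd.1.2.2, hnd.2.1.2, hnd.2.2⟩
  rcases hNB s l hs h with h' | h' <;> rw [h'] at hl <;> simp only [Finset.mem_insert,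
    Finset.mem_singleton] at hl
  · rcases hl with rfl | rfl
    · exact hnd'.1 rfl
    · exact hnd'.2.1 rfl
  · rcases hl with rfl | rfl
    · exact hnd'.2.1 rfl
    · exact hnd'.2.2 rfl

include hT hX1 hcard hsepX hB hBcard hv hwX hwinj hwv hvw hnd hBij hBjk in
open scoped Classical in
/-- **No third facet through the `α`-bond `{v, w j}`**: a facet containing `v` and `w j` is one
of the two bond triangles `{v, w i, w j}`, `{v, w j, w k}`. -/
theorem facet_through_alpha (c : EuclideanSpace ℝ (Fin 3)) (hcF : c ∈ facetNormals X)
    (hvc : v ∈ tightSet X c) (hjc : w j ∈ tightSet X c) :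
    tightSet X c = {v, w i, w j} ∨ tightSet X c = {v, w j, w k} := by
  obtain ⟨h0, hBH, -⟩ := hull_counts_of_twelve hT hX1 hcard hsepX hB hBcard
  have hnd' : i ≠ j ∧ j ≠ k ∧ i ≠ k := by
    simp only [List.nodup_cons, List.mem_cons, not_or, List.not_mem_nil,
      not_false_eq_true, and_true, List.nodup_nil] at hnd
    exact ⟨hnd.1.1, hnd.2.1.1, hnd.1.2.1⟩
  obtain ⟨c₁, hc₁F, hc₁T, -⟩ :=
    bondTriangle_at_of_mem_bonds hX1 hsepX hB hv w hwX hwinj hwv hvw hnd'.1 hBij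
  obtain ⟨c₂, hc₂F, hc₂T, -⟩ :=
    bondTriangle_at_of_mem_bonds hX1 hsepX hB hv w hwX hwinj hwv hvw hnd'.2.1 hBjk
  by_contra hne
  push Not at hne
  have hsub : ∀ c', c' ∈ facetNormals X → v ∈ tightSet X c' → w j ∈ tightSet X c' →
      ({v, w j} : Finset (EuclideanSpace ℝ (Fin 3))) ⊆ tightSet X c' := by
    intro c' _ h1 h2 y hy
    rw [Finset.mem_insert, Finset.mem_singleton] at hy
    rcases hy with rfl | rfl <;> assumption
  have h1v : v ∈ tightSet X c₁ := by rw [hc₁T]; simp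
  have h1j : w j ∈ tightSet X c₁ := by rw [hc₁T]; simp
  have h2v : v ∈ tightSet X c₂ := by rw [hc₂T]; simp
  have h2j : w j ∈ tightSet X c₂ := by rw [hc₂T]; simp
  have h12 : c₁ ≠ c₂ := by
    intro h
    have : w i ∈ tightSet X c₂ := by rw [← h, hc₁T]; simp
    rw [hc₂T] at this
    simp only [Finset.mem_insert, Finset.mem_singleton] at this
    rcases this with h' | h' | h'
    · exact hwv i h'
    · exact hnd'.1 (hwinj h')
    · exact hnd'.2.2 (hwinj h')
  have h13 : c₁ ≠ c := fun h => hne.1 (by rw [← h, hc₁T])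
  have h23 : c₂ ≠ c := fun h => hne.2 (by rw [← h, hc₂T])
  exact false_of_three_facetsOfEdge hX1 h0 (hBH (hvw j)) hc₁F hc₂F hcF (hsub c₁ hc₁F h1v h1j)
    (hsub c₂ hc₂F h2v h2j) (hsub c hcF hvc hjc) h12 h13 h23


include hB hnd hNB in
/-- A point bonded to the `γ`-partner `w l` and different from `v` is not a bond of `v`. -/
theorem ne_link_of_bond_gamma {x : EuclideanSpace ℝ (Fin 3)}
    (hx : ({x, w l} : Finset (EuclideanSpace ℝ (Fin 3))) ∈ B) : ∀ s, x ≠ w s := by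
  intro s hs
  subst hs
  have hsl : s ≠ l := fun h => ne_of_mem_bonds hB hx (by rw [h])
  exact not_mem_bonds_gamma w hnd hNB s hsl hx

end Setting

end Summit.AtomisticToContinuum.Crystallization.Theorems
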